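import Summits.QuantumFields.YangMills.Theorems.SwapVirialDeficitZeroModeSigmaFourSmallBallRateShell
import Summits.QuantumFields.YangMills.Theorems.SwapVirialDeficitZeroModeGroupThreeLaplaceRateWeights
import HarnessLib

/-!
# Exact zero-mode rung Z5 — toward the POWER RATE of the σ-twisted four-leader small ball, measure side II: transverse moments of the dominator
# (free-hands support of ⟨stmt-QuantumFields-24197⟩; split with w3 g63 agreed on STATUS 10:58Z/11:03Z)

The bad regions of the rate (large transverse/axial ratios, ball-flip layers) are cut by Markov's inequality against w3 g63's `t`-free dominator
`sigmaDom A = 𝟙𝟙𝟙·e^{4 − qLoad}` (✓`indicator_rescaledSigma_le_sigmaDom`), whose pair-frame majorant is `𝟙_box(x₀,y₀)·𝟙_box(q)·gS(q,w_J)·gS(q,w_K)`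
(✓`FdomS`).  This file pays ONE transverse moment `(x_c²)^p` or `(y_c²)^p` with half of the coupled Gaussian `gS`:
* §C ★ `lintegral_rpow_fst_mul_exp_quadForm_le` — for a positive binary form `Q = au² + 2guv + dv²`, `D = ad − g²`:
  `∫(u²)^p e^{−Q} ≤ (2d/D)^p·(2π/√D)` (`0 < p ≤ 1`; `Q ≥ (D/d)u²` + w2 g56's ✓`rpow_mul_exp_neg_le`), and the `v`-twin;
* §D ★ `lintegral_momJ_gS_le` / `lintegral_momK_gS_le` — for the load form (`|x_I|,|y_I| < 1`, `α²+β²=1`, `αβ ≠ 0`): each moment costs `2·(4/(α²β⁴))^p`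
  times the exact `∫gS = π/√(4β²Den)` (`den_pos'`: `Den ≥ α²β² > 0`);
* §E ★★ `lintegral_block_weighted_le` — the transverse block with one weighted factor: `∫𝟙_box(q)·F(q,w_J)·gS(q,w_K) ≤ K·hubK·I(1/3)²` whenever
  `∫F(q,·) ≤ K·∫gS(q,·)` (Tonelli + ✓`gaussSqS_le_sing`), and its mirror.
HONEST LABEL: finite-dimensional real analysis (plan-level zero-mode rung of a DRAFT line «sharp-sigma»); NOT the fixed-`L` sharp law, NOT ⟨24197⟩; the
Yang–Mills mass gap is NOT proved; no summit is proved by a line.  Width seat ym-line-sfw-p2-w2 g56 (cell ym-idea-1, free hands; own crux ⟨22884⟩ blocked-on ⟨19935⟩),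
`--supports stmt-QuantumFields-24197`.  THEOREMS ONLY, standard axioms, 0 `sorry`.  References: [cite: Luscher1983, §2]; [cite: Vanbaal2001]; [folklore].
-/

set_option autoImplicit false

noncomputable section

open MeasureTheory Quaternion Set Filter Topology
open scoped Quaternion ENNReal BigOperators
open Literature.MathematicalPhysics.QuantumLattice
open Summit.QuantumFields.YangMills.Theorems.SwapTwistDeficit.ToronLog
open Summit.QuantumFields.YangMills.Theorems.SwapVirialDeficit.ZeroModeGroup

namespace Summit.QuantumFields.YangMills.Theorems.SwapVirialDeficit.ZeroModeSigma

/-! ## §C One moment against a coupled binary Gaussian -/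

/-- A positive binary form dominates its first variable: `au² + 2guv + dv² ≥ (ad − g²)/d · u²` (`d > 0`). [folklore] -/
theorem quadForm_ge_fst {a g d : ℝ} (hd : 0 < d) (u v : ℝ) : (a * d - g ^ 2) / d * u ^ 2 ≤ a * u ^ 2 + 2 * g * u * v + d * v ^ 2 := by
  have e : a * u ^ 2 + 2 * g * u * v + d * v ^ 2 - (a * d - g ^ 2) / d * u ^ 2 = (g * u + d * v) ^ 2 / d := by
    field_simp; ring
  have : 0 ≤ (g * u + d * v) ^ 2 / d := by positivity
  linarith

/-- ★ **First-variable moment**: `∫(u²)^p e^{−(au²+2guv+dv²)} ≤ (2d/D)^p·(2π/√D)`, `D = ad − g² > 0`, `d > 0`, `0 < p ≤ 1`. [folklore] -/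
theorem lintegral_rpow_fst_mul_exp_quadForm_le {a g d p : ℝ} (hd : 0 < d) (hD : 0 < a * d - g ^ 2) (hp : 0 < p) (hp1 : p ≤ 1) :
    ∫⁻ w : ℝ × ℝ, ENNReal.ofReal ((w.1 ^ 2) ^ p) * ENNReal.ofReal (Real.exp (-(a * w.1 ^ 2 + 2 * g * w.1 * w.2 + d * w.2 ^ 2))) ≤
      ENNReal.ofReal ((2 * d / (a * d - g ^ 2)) ^ p) * ENNReal.ofReal (2 * Real.pi / Real.sqrt (a * d - g ^ 2)) := by
  set D := a * d - g ^ 2 with hDdef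
  have hc : 0 < D / (2 * d) := by positivity
  -- pointwise: `(u²)^p e^{−Q/2} ≤ (2d/D)^p`
  have hpt : ∀ w : ℝ × ℝ, ENNReal.ofReal ((w.1 ^ 2) ^ p) * ENNReal.ofReal (Real.exp (-(a * w.1 ^ 2 + 2 * g * w.1 * w.2 + d * w.2 ^ 2))) ≤
      ENNReal.ofReal ((2 * d / D) ^ p) * ENNReal.ofReal (Real.exp (-(a / 2 * w.1 ^ 2 + 2 * (g / 2) * w.1 * w.2 + d / 2 * w.2 ^ 2))) := by
    intro w
    rw [← ENNReal.ofReal_mul (Real.rpow_nonneg (sq_nonneg _) _), ← ENNReal.ofReal_mul (by positivity)]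
    refine ENNReal.ofReal_le_ofReal ?_
    have hQ := quadForm_ge_fst (a := a) (g := g) hd w.1 w.2
    have hsplit : Real.exp (-(a * w.1 ^ 2 + 2 * g * w.1 * w.2 + d * w.2 ^ 2)) =
        Real.exp (-((a * w.1 ^ 2 + 2 * g * w.1 * w.2 + d * w.2 ^ 2) / 2)) * Real.exp (-(a / 2 * w.1 ^ 2 + 2 * (g / 2) * w.1 * w.2 + d / 2 * w.2 ^ 2)) := by
      rw [← Real.exp_add]; congr 1; ring
    rw [hsplit, ← mul_assoc]
    refine mul_le_mul_of_nonneg_right ?_ (Real.exp_pos _).le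
    have h1 : Real.exp (-((a * w.1 ^ 2 + 2 * g * w.1 * w.2 + d * w.2 ^ 2) / 2)) ≤ Real.exp (-(D / (2 * d) * w.1 ^ 2)) := by
      refine Real.exp_le_exp.2 (neg_le_neg ?_)
      have : D / (2 * d) * w.1 ^ 2 = (D / d * w.1 ^ 2) / 2 := by field_simp
      rw [this]; linarith
    have h2 := rpow_mul_exp_neg_le (sq_nonneg w.1) hc hp
    calc (w.1 ^ 2) ^ p * Real.exp (-((a * w.1 ^ 2 + 2 * g * w.1 * w.2 + d * w.2 ^ 2) / 2))
        ≤ (w.1 ^ 2) ^ p * Real.exp (-(D / (2 * d) * w.1 ^ 2)) := mul_le_mul_of_nonneg_left h1 (Real.rpow_nonneg (sq_nonneg _) _)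
      _ ≤ (p / (D / (2 * d))) ^ p := h2
      _ ≤ (2 * d / D) ^ p := by
          refine Real.rpow_le_rpow (by positivity) ?_ hp.le
          rw [div_div_eq_mul_div]
          have : p * (2 * d) / D ≤ 1 * (2 * d) / D := by gcongr
          simpa using this
  have hm : Measurable fun w : ℝ × ℝ => ENNReal.ofReal (Real.exp (-(a / 2 * w.1 ^ 2 + 2 * (g / 2) * w.1 * w.2 + d / 2 * w.2 ^ 2))) :=
    ENNReal.measurable_ofReal.comp (Real.measurable_exp.comp (by fun_prop))
  refine (lintegral_mono hpt).trans ?_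
  rw [lintegral_const_mul _ hm, lintegral_exp_neg_quadForm_two (by positivity) (by nlinarith : 0 < a / 2 * (d / 2) - (g / 2) ^ 2)]
  refine mul_le_mul' le_rfl (ENNReal.ofReal_le_ofReal (le_of_eq ?_))
  have hD4 : a / 2 * (d / 2) - (g / 2) ^ 2 = D / 4 := by rw [hDdef]; ring
  rw [hD4, Real.sqrt_div' _ (by norm_num : (0:ℝ) ≤ 4), show Real.sqrt 4 = 2 by rw [show (4:ℝ) = 2 ^ 2 by norm_num, Real.sqrt_sq (by norm_num)]]
  field_simp

/-- ★ **Second-variable moment** (the mirror): `∫(v²)^p e^{−(au²+2guv+dv²)} ≤ (2a/D)^p·(2π/√D)` (`a > 0`, `D > 0`, `0 < p ≤ 1`). [folklore] -/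
theorem lintegral_rpow_snd_mul_exp_quadForm_le {a g d p : ℝ} (ha : 0 < a) (hD : 0 < a * d - g ^ 2) (hp : 0 < p) (hp1 : p ≤ 1) :
    ∫⁻ w : ℝ × ℝ, ENNReal.ofReal ((w.2 ^ 2) ^ p) * ENNReal.ofReal (Real.exp (-(a * w.1 ^ 2 + 2 * g * w.1 * w.2 + d * w.2 ^ 2))) ≤
      ENNReal.ofReal ((2 * a / (a * d - g ^ 2)) ^ p) * ENNReal.ofReal (2 * Real.pi / Real.sqrt (a * d - g ^ 2)) := by
  have hswap := (Measure.measurePreserving_swap (μ := (volume : Measure ℝ)) (ν := (volume : Measure ℝ))).lintegral_comp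
    (f := fun w : ℝ × ℝ => ENNReal.ofReal ((w.1 ^ 2) ^ p) * ENNReal.ofReal (Real.exp (-(d * w.1 ^ 2 + 2 * g * w.1 * w.2 + a * w.2 ^ 2))))
    ((ENNReal.measurable_ofReal.comp (by fun_prop)).mul (ENNReal.measurable_ofReal.comp (Real.measurable_exp.comp (by fun_prop))))
  rw [← Measure.volume_eq_prod] at hswap
  have e : ∫⁻ w : ℝ × ℝ, ENNReal.ofReal ((w.2 ^ 2) ^ p) * ENNReal.ofReal (Real.exp (-(a * w.1 ^ 2 + 2 * g * w.1 * w.2 + d * w.2 ^ 2))) =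
      ∫⁻ w : ℝ × ℝ, ENNReal.ofReal (((Prod.swap w).1 ^ 2) ^ p) *
        ENNReal.ofReal (Real.exp (-(d * (Prod.swap w).1 ^ 2 + 2 * g * (Prod.swap w).1 * (Prod.swap w).2 + a * (Prod.swap w).2 ^ 2))) := by
    refine lintegral_congr fun w => ?_
    simp only [Prod.fst_swap, Prod.snd_swap]
    congr 3; ring
  rw [e, hswap]
  have h := lintegral_rpow_fst_mul_exp_quadForm_le (a := d) (g := g) (d := a) ha (by nlinarith) hp hp1
  rwa [show d * a - g ^ 2 = a * d - g ^ 2 by ring] at h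

/-! ## §D The load form: one transverse moment costs `(4/(α²β⁴))^p` -/

/-- `Den ≥ α²β² > 0` for `αβ ≠ 0` (no condition on `y_I`). [folklore] -/
theorem den_pos' {α β : ℝ} (hα : α ≠ 0) (hβ : β ≠ 0) (q : ℝ × ℝ) : 0 < den α β q := by
  rw [den_def]
  have : 0 < α ^ 2 * β ^ 2 := by positivity
  nlinarith [sq_nonneg q.1, sq_nonneg q.2, mul_nonneg (sq_nonneg q.1) (sq_nonneg α), mul_nonneg (sq_nonneg β) (sq_nonneg q.1),
    mul_nonneg (sq_nonneg q.1) (sq_nonneg q.1)]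

/-- The bookkeeping of the load form on the box: `d = 4(β²+x_I²) ≤ 8`, `a ≤ 8`, `D = 4β²Den ≥ 4α²β⁴`, so `2d/D, 2a/D ≤ 4/(α²β⁴)`. [folklore] -/
theorem load_ratio_le {α β : ℝ} (h1 : α ^ 2 + β ^ 2 = 1) (hα : α ≠ 0) (hβ : β ≠ 0) {q : ℝ × ℝ} (hq1 : q.1 ^ 2 < 1) (hq2 : q.2 ^ 2 < 1) :
    2 * (4 * (β ^ 2 + q.1 ^ 2)) / (4 * β ^ 2 * den α β q) ≤ 4 / (α ^ 2 * β ^ 4) ∧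
      2 * (β ^ 2 * (α ^ 2 + 16 / 9 * q.1 ^ 2) + 4 * q.2 ^ 2) / (4 * β ^ 2 * den α β q) ≤ 4 / (α ^ 2 * β ^ 4) := by
  have hden : α ^ 2 * β ^ 2 ≤ den α β q := by have := den_ge h1 q; nlinarith [sq_nonneg q.1, sq_nonneg q.2]
  have hαβ : 0 < α ^ 2 * β ^ 4 := by positivity
  have hD : 0 < 4 * β ^ 2 * den α β q := by have := den_pos' hα hβ q; positivity
  have hβ2 : β ^ 2 ≤ 1 := by nlinarith [sq_nonneg α]
  have hα2 : α ^ 2 ≤ 1 := by nlinarith [sq_nonneg β]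
  have hD' : 4 * (α ^ 2 * β ^ 4) ≤ 4 * β ^ 2 * den α β q := by nlinarith [sq_nonneg β, mul_le_mul_of_nonneg_left hden (sq_nonneg β)]
  constructor
  · rw [div_le_div_iff₀ hD hαβ]
    have hn : 2 * (4 * (β ^ 2 + q.1 ^ 2)) ≤ 16 := by nlinarith
    nlinarith [mul_le_mul hn hD' (by positivity) (by norm_num), hαβ]
  · rw [div_le_div_iff₀ hD hαβ]
    have hn : 2 * (β ^ 2 * (α ^ 2 + 16 / 9 * q.1 ^ 2) + 4 * q.2 ^ 2) ≤ 16 := by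
      nlinarith [mul_nonneg (sq_nonneg β) (sq_nonneg q.1), sq_nonneg q.1]
    have h0 : 0 ≤ 2 * (β ^ 2 * (α ^ 2 + 16 / 9 * q.1 ^ 2) + 4 * q.2 ^ 2) := by positivity
    nlinarith [mul_le_mul hn hD' (by positivity) (by norm_num), hαβ]

/-- ★ **`x_c`-moment of the load Gaussian**: `∫ (w₁²)^p·gS α β q w dw ≤ (4/(α²β⁴))^p · 2·∫gS α β q` on the box (`q.2 ≠ 0`, `0 < p ≤ 1`). [folklore] -/
theorem lintegral_momJ_gS_le {α β p : ℝ} (h1 : α ^ 2 + β ^ 2 = 1) (hα : α ≠ 0) (hβ : β ≠ 0) (hp : 0 < p) (hp1 : p ≤ 1) {q : ℝ × ℝ}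
    (hq1 : q.1 ^ 2 < 1) (hq2 : q.2 ^ 2 < 1) (hq0 : q.2 ≠ 0) :
    ∫⁻ w, ENNReal.ofReal ((w.1 ^ 2) ^ p) * gS α β q w ≤ ENNReal.ofReal ((4 / (α ^ 2 * β ^ 4)) ^ p * 2) * ∫⁻ w, gS α β q w := by
  have hD : 0 < 4 * β ^ 2 * den α β q := by have := den_pos' hα hβ q; positivity
  have hd : 0 < 4 * (β ^ 2 + q.1 ^ 2) := by positivity
  rw [lintegral_gS hβ hq0]
  simp_rw [gS_def]
  have h := lintegral_rpow_fst_mul_exp_quadForm_le (a := β ^ 2 * (α ^ 2 + 16 / 9 * q.1 ^ 2) + 4 * q.2 ^ 2) (g := -(4 * q.1 * q.2))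
    (d := 4 * (β ^ 2 + q.1 ^ 2)) hd (by rw [discr_gS]; exact hD) hp hp1
  rw [discr_gS] at h
  refine h.trans ?_
  rw [← ENNReal.ofReal_mul (by positivity), ← ENNReal.ofReal_mul (by positivity)]
  refine ENNReal.ofReal_le_ofReal ?_
  have hr := (load_ratio_le h1 hα hβ hq1 hq2).1
  have hrp : (2 * (4 * (β ^ 2 + q.1 ^ 2)) / (4 * β ^ 2 * den α β q)) ^ p ≤ (4 / (α ^ 2 * β ^ 4)) ^ p := Real.rpow_le_rpow (by positivity) hr hp.le
  have hpos : 0 ≤ Real.pi / Real.sqrt (4 * β ^ 2 * den α β q) := by positivity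
  calc (2 * (4 * (β ^ 2 + q.1 ^ 2)) / (4 * β ^ 2 * den α β q)) ^ p * (2 * Real.pi / Real.sqrt (4 * β ^ 2 * den α β q))
      = (2 * (4 * (β ^ 2 + q.1 ^ 2)) / (4 * β ^ 2 * den α β q)) ^ p * 2 * (Real.pi / Real.sqrt (4 * β ^ 2 * den α β q)) := by ring
    _ ≤ (4 / (α ^ 2 * β ^ 4)) ^ p * 2 * (Real.pi / Real.sqrt (4 * β ^ 2 * den α β q)) := by gcongr

/-- ★ **`y_c`-moment of the load Gaussian**: the same for `(w₂²)^p`. [folklore] -/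
theorem lintegral_momK_gS_le {α β p : ℝ} (h1 : α ^ 2 + β ^ 2 = 1) (hα : α ≠ 0) (hβ : β ≠ 0) (hp : 0 < p) (hp1 : p ≤ 1) {q : ℝ × ℝ}
    (hq1 : q.1 ^ 2 < 1) (hq2 : q.2 ^ 2 < 1) (hq0 : q.2 ≠ 0) :
    ∫⁻ w, ENNReal.ofReal ((w.2 ^ 2) ^ p) * gS α β q w ≤ ENNReal.ofReal ((4 / (α ^ 2 * β ^ 4)) ^ p * 2) * ∫⁻ w, gS α β q w := by
  have hD : 0 < 4 * β ^ 2 * den α β q := by have := den_pos' hα hβ q; positivity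
  have ha : 0 < β ^ 2 * (α ^ 2 + 16 / 9 * q.1 ^ 2) + 4 * q.2 ^ 2 := by positivity
  rw [lintegral_gS hβ hq0]
  simp_rw [gS_def]
  have h := lintegral_rpow_snd_mul_exp_quadForm_le (a := β ^ 2 * (α ^ 2 + 16 / 9 * q.1 ^ 2) + 4 * q.2 ^ 2) (g := -(4 * q.1 * q.2))
    (d := 4 * (β ^ 2 + q.1 ^ 2)) ha (by rw [discr_gS]; exact hD) hp hp1
  rw [discr_gS] at h
  refine h.trans ?_
  rw [← ENNReal.ofReal_mul (by positivity), ← ENNReal.ofReal_mul (by positivity)]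
  refine ENNReal.ofReal_le_ofReal ?_
  have hr := (load_ratio_le h1 hα hβ hq1 hq2).2
  have hrp : (2 * (β ^ 2 * (α ^ 2 + 16 / 9 * q.1 ^ 2) + 4 * q.2 ^ 2) / (4 * β ^ 2 * den α β q)) ^ p ≤ (4 / (α ^ 2 * β ^ 4)) ^ p :=
    Real.rpow_le_rpow (by positivity) hr hp.le
  have hpos : 0 ≤ Real.pi / Real.sqrt (4 * β ^ 2 * den α β q) := by positivity
  calc (2 * (β ^ 2 * (α ^ 2 + 16 / 9 * q.1 ^ 2) + 4 * q.2 ^ 2) / (4 * β ^ 2 * den α β q)) ^ p * (2 * Real.pi / Real.sqrt (4 * β ^ 2 * den α β q))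
      = (2 * (β ^ 2 * (α ^ 2 + 16 / 9 * q.1 ^ 2) + 4 * q.2 ^ 2) / (4 * β ^ 2 * den α β q)) ^ p * 2 * (Real.pi / Real.sqrt (4 * β ^ 2 * den α β q)) := by ring
    _ ≤ (4 / (α ^ 2 * β ^ 4)) ^ p * 2 * (Real.pi / Real.sqrt (4 * β ^ 2 * den α β q)) := by gcongr

/-! ## §E The transverse block with one weighted factor -/

/-- ★★ **WEIGHTED TRANSVERSE BLOCK**: if a measurable `F(q, ·)` satisfies `∫F(q,·) ≤ K·∫gS(q,·)` for every box point `q` with `q.2 ≠ 0`, then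
`∫ 𝟙_box(q)·F(q,w_J)·gS(q,w_K) d(q,w_J,w_K) ≤ K·hubK(α,β)·I(1/3)²` (axial unit hub, `αβ ≠ 0`). [folklore] -/
theorem lintegral_block_weighted_le {α β : ℝ} (h1 : α ^ 2 + β ^ 2 = 1) (hα : α ≠ 0) (hβ : β ≠ 0) {K : ℝ≥0∞}
    {F : (ℝ × ℝ) → (ℝ × ℝ) → ℝ≥0∞} (hFm : Measurable fun v : (ℝ × ℝ) × (ℝ × ℝ) => F v.1 v.2)
    (hF : ∀ q : ℝ × ℝ, q.1 ^ 2 < 1 → q.2 ^ 2 < 1 → q.2 ≠ 0 → ∫⁻ w, F q w ≤ K * ∫⁻ w, gS α β q w) :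
    ∫⁻ u : (ℝ × ℝ) × ((ℝ × ℝ) × (ℝ × ℝ)), sqBox.indicator (fun _ => (1 : ℝ≥0∞)) u.1 * (F u.1 u.2.1 * gS α β u.1 u.2.2) ≤
      K * (ENNReal.ofReal (hubK α β) * (Ising (1/3) * Ising (1/3))) := by
  have hmeas : Measurable fun u : (ℝ × ℝ) × ((ℝ × ℝ) × (ℝ × ℝ)) => sqBox.indicator (fun _ => (1 : ℝ≥0∞)) u.1 * (F u.1 u.2.1 * gS α β u.1 u.2.2) := by
    have hi : Measurable fun q : ℝ × ℝ => sqBox.indicator (fun _ => (1 : ℝ≥0∞)) q := measurable_const.indicator measurableSet_sqBox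
    exact (hi.comp measurable_fst).mul ((hFm.comp (measurable_fst.prodMk (measurable_fst.comp measurable_snd))).mul
      ((measurable_gS α β).comp (measurable_fst.prodMk (measurable_snd.comp measurable_snd))))
  rw [lintegral_volume_prod _ hmeas]
  have hFq : ∀ q : ℝ × ℝ, Measurable (F q) := fun q => hFm.comp (measurable_const.prodMk measurable_id)
  have hin : ∀ q : ℝ × ℝ, ∫⁻ v : (ℝ × ℝ) × (ℝ × ℝ), sqBox.indicator (fun _ => (1 : ℝ≥0∞)) q * (F q v.1 * gS α β q v.2) =
      sqBox.indicator (fun _ => (1 : ℝ≥0∞)) q * ((∫⁻ w, F q w) * (∫⁻ w, gS α β q w)) := by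
    intro q
    have hm : Measurable fun v : (ℝ × ℝ) × (ℝ × ℝ) => F q v.1 * gS α β q v.2 :=
      ((hFq q).comp measurable_fst).mul ((measurable_gS_right α β q).comp measurable_snd)
    rw [lintegral_const_mul _ hm, lintegral_volume_prod_mul (hFq q) (measurable_gS_right α β q)]
  simp_rw [hin]
  -- a.e. `q.2 ≠ 0`
  have hae : ∀ᵐ q : ℝ × ℝ, q.2 ≠ 0 := by
    have h : ∀ᵐ y : ℝ, y ≠ 0 := by simp [ae_iff]
    exact (Measure.quasiMeasurePreserving_snd (μ := (volume : Measure ℝ)) (ν := (volume : Measure ℝ))).ae h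
  calc ∫⁻ q : ℝ × ℝ, sqBox.indicator (fun _ => (1 : ℝ≥0∞)) q * ((∫⁻ w, F q w) * (∫⁻ w, gS α β q w))
      ≤ ∫⁻ q : ℝ × ℝ, K * (ENNReal.ofReal (hubK α β) *
          ({u : ℝ | u ^ 2 < 1}.indicator (singPow (1/3)) q.1 * {u : ℝ | u ^ 2 < 1}.indicator (singPow (1/3)) q.2)) := by
        refine lintegral_mono_ae (hae.mono fun q hq0 => ?_)
        by_cases hq : q ∈ sqBox
        · rw [indicator_of_mem hq, one_mul, indicator_of_mem hq.1, indicator_of_mem hq.2]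
          have hq1 : q.1 ^ 2 < 1 := hq.1
          have hq2 : q.2 ^ 2 < 1 := hq.2
          calc (∫⁻ w, F q w) * (∫⁻ w, gS α β q w) ≤ (K * ∫⁻ w, gS α β q w) * (∫⁻ w, gS α β q w) := mul_le_mul' (hF q hq1 hq2 hq0) le_rfl
            _ = K * ((∫⁻ w, gS α β q w) * (∫⁻ w, gS α β q w)) := by ring
            _ ≤ K * (ENNReal.ofReal (hubK α β) * (singPow (1/3) q.1 * singPow (1/3) q.2)) := by
                rw [lintegral_gS_mul_self hβ hq0]
                exact mul_le_mul' le_rfl (gaussSqS_le_sing h1 hα hβ q.1 q.2 hq0)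
        · rw [indicator_of_notMem hq, zero_mul]; exact bot_le
    _ = _ := by
        have hm' : Measurable fun q : ℝ × ℝ =>
            {u : ℝ | u ^ 2 < 1}.indicator (singPow (1/3)) q.1 * {u : ℝ | u ^ 2 < 1}.indicator (singPow (1/3)) q.2 :=
          ((measurable_boxSing _).comp measurable_fst).mul ((measurable_boxSing _).comp measurable_snd)
        rw [lintegral_const_mul _ (hm'.const_mul _), lintegral_const_mul _ hm', lintegral_volume_prod_mul (measurable_boxSing _) (measurable_boxSing _)]
        rfl

end Summit.QuantumFields.YangMills.Theorems.SwapVirialDeficit.ZeroModeSigma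

end
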